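import Summits.Ventures.QEC.Census.CertCommFast
import Summits.Ventures.QEC.Census.CertCheckBZAutSound
import Mathlib.Data.Nat.Bitwise
import HarnessLib

/-!
# Kernel-fast rank certificates, logical-basis pairing and `bzCoreOK` through column words — bridges, no statement change
# (qec-type-12 g4; the second n ≥ 200 blocker of one-sided KERNEL rows, INBOX 04:35Z / 05:2xZ; sibling of `CertCommFast.lean`)

type-02's `RankCert.check n H c` (`Census/RankCert.lean`) verifies the pivot block by the `r × r` parity table
`popc n (H[pivots[a]] &&& rinv[i]) % 2 = [a = i]` — `r²` popcounts of `n`-bit words (`r = 127`, `n = 270`: measured kernel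
resource failure at 152 s).  Row `a` of that table is the LABEL of the pivot row w.r.t. the `rinv` supports, i.e. the XOR of
the COLUMN words of `rinv` selected by the (sparse) pivot row: `xorSel (colWords n c.rinv) H[pivots[a]] = labelWord n c.rinv _`
(`BZAutPermFast.xorSel_colWords`), and the table says it equals the unit word `2^a`.  So:

* `RankCert.checkCols H c colsM` — `check` with the parity table replaced by `r` comparisons
  `xorSel colsM H[pivots[a]] == 2^a` on column words `colsM` supplied as DATA (one `decide` of `colWords n c.rinv = colsM`);
  the `dependent`-row part is unchanged; cost `O(r·n + |H|·r)` instead of `O(r²·n)`;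
* `RankCert.check_of_checkCols (hcols : colWords n c.rinv = colsM) : c.checkCols H colsM = true → c.check n H = true` —
  so `rank_rowMatrix_of_check`, `DistCert.k_code`, `isCode_of_onesided(_lower)`, `bzCoreOK` consumers apply verbatim.

* `logOKCols colsSyn colsStab colsLd L Ld` — type-10's `logOK` (logicals in the kernels: `k·(|Hsyn|+|Hstab|)` popcounts;
  pairing `⟨L_i, Ld_j⟩ = [i = j]`: `k²` popcounts) through the column words of `Hsyn`, `Hstab` (the SAME data as
  `DistCert.checkStructureCols`) and of `Ld`; bridge `logOK_of_cols`;
* `bzCoreOKCols` = type-10's `bzCoreOK` (`CertCheckBZAutSound`) with both rank certificates and `logOK` in column form,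
  dimension count and parity witness unchanged; bridge `bzCoreOK_of_cols` — the `hcore` input of `bzAut_lower_sound[_sem]`,
  `bzAut_perm_lower[…]`, `blockBound_of_bzBlockOK`, … .

MEASURED (farm, `decide +kernel`, the one-sided `[[270,16,6]]` row, 135 + 135 check rows, `r = 127`): `RankCert.check`
kernel resource failure at 152 s → `colWords` of `rinv` + `checkCols` + bridge 26 s wall (data baseline ≈ 18 s included).
type-05's `RankRREF` (p494069) is the general large-`n` rank primitive; this file is the drop-in for the EXISTING `RankCert`
data of emitted certificates (no format change).  Tier KERNEL, axioms standard; controls `[[4,2,2]]` / Steane by `decide`.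
-/

namespace Summit.Ventures.QEC.Census

namespace RankCert

/-- **Rank certificate check through column words**: lengths and index ranges as in `pivotsOK`, the parity table as
`xorSel colsM H[pivots[a]] = 2^a` for every `a < r` (`colsM` = the column words of the `rinv` supports), and the
`dependent`-row check `rowOK` unchanged. (definition, `decide +kernel`) -/
def checkCols (H : List ℕ) (c : RankCert) (colsM : List ℕ) : Bool :=
  (c.pivots.length == c.r) && (c.rinv.length == c.r) && c.pivots.all (fun p => decide (p < H.length)) &&
    ((List.range c.r).all fun a => xorSel colsM (H.getD (c.pivots.getD a 0) 0) == 2 ^ a) &&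
    (List.range H.length).all (c.rowOK H)

/-- **Bridge**: with `colWords n c.rinv = colsM`, the column-word check implies `RankCert.check`. -/
theorem check_of_checkCols {n : ℕ} {H : List ℕ} {c : RankCert} {colsM : List ℕ} (hcols : colWords n c.rinv = colsM)
    (h : c.checkCols H colsM = true) : c.check n H = true := by
  subst hcols
  simp only [checkCols, Bool.and_eq_true, List.all_eq_true, List.mem_range, beq_iff_eq, decide_eq_true_eq] at h
  obtain ⟨⟨⟨⟨hpl, hrl⟩, hpr⟩, htab⟩, hrows⟩ := h
  simp only [check, pivotsOK, Bool.and_eq_true, List.all_eq_true, List.mem_range, beq_iff_eq, decide_eq_true_eq]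
  refine ⟨⟨⟨⟨hpl, hrl⟩, hpr⟩, fun a ha i hi => ?_⟩, hrows⟩
  -- row `a` of the parity table is the label word of the pivot row, which is `2^a`
  have hlab : labelWord n c.rinv (H.getD (c.pivots.getD a 0) 0) = 2 ^ a := by
    rw [← xorSel_colWords]; exact htab a ha
  have hbit := testBit_labelWord n c.rinv (H.getD (c.pivots.getD a 0) 0) i
  rw [hlab, Nat.testBit_two_pow] at hbit
  -- `hbit : decide (a = i) = decide (popc n (rinv[i] &&& row) % 2 = 1)`
  rw [Nat.land_comm] at hbit
  have hmod := Nat.mod_two_eq_zero_or_one (popc n (H.getD (c.pivots.getD a 0) 0 &&& c.rinv.getD i 0))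
  by_cases hai : a = i
  · subst hai
    simp only [decide_true, if_true] at hbit ⊢
    rcases hmod with h0 | h1
    · rw [h0] at hbit; simp at hbit
    · exact h1
  · rw [if_neg hai]
    simp only [hai, decide_false] at hbit
    rcases hmod with h0 | h1
    · exact h0
    · rw [h1] at hbit; simp at hbit

end RankCert

/-! ## `logOK` and `bzCoreOK` through column words -/

/-- **Logical-basis check through column words**: `|L| = |Ld|`, every `L`-word has zero syndrome w.r.t. `Hsyn`
(`colsSyn = colWords n Hsyn`), every `Ld`-word w.r.t. `Hstab` (`colsStab`), and the pairing: the label of `L[i]` w.r.t. the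
rows `Ld` (`xorSel colsLd L[i]`, `colsLd = colWords n Ld`) is the unit word `2^i`. (definition, `decide +kernel`) -/
def logOKCols (colsSyn colsStab colsLd L Ld : List ℕ) : Bool :=
  (L.length == Ld.length) && (L.all fun l => synZeroCols colsSyn l) && (Ld.all fun l => synZeroCols colsStab l) &&
    ((List.range L.length).all fun i => xorSel colsLd (L.getD i 0) == 2 ^ i)

/-- **Bridge** for `logOK`. -/
theorem logOK_of_cols {n : ℕ} {Hsyn Hstab L Ld colsSyn colsStab colsLd : List ℕ} (hS : colWords n Hsyn = colsSyn)
    (hT : colWords n Hstab = colsStab) (hL : colWords n Ld = colsLd) (h : logOKCols colsSyn colsStab colsLd L Ld = true) :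
    logOK n Hsyn Hstab L Ld = true := by
  subst hL
  simp only [logOKCols, Bool.and_eq_true, List.all_eq_true, List.mem_range, beq_iff_eq] at h
  obtain ⟨⟨⟨hlen, hLs⟩, hLd⟩, hpair⟩ := h
  simp only [logOK, Bool.and_eq_true, List.all_eq_true, List.mem_range, beq_iff_eq]
  refine ⟨⟨⟨hlen, fun l hl => synZero_of_synZeroCols hS (hLs l hl)⟩, fun l hl => synZero_of_synZeroCols hT (hLd l hl)⟩,
    fun i hi j hj => ?_⟩
  have hlab : labelWord n Ld (L.getD i 0) = 2 ^ i := by rw [← xorSel_colWords]; exact hpair i hi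
  have hbit := testBit_labelWord n Ld (L.getD i 0) j
  rw [hlab, Nat.testBit_two_pow, Nat.land_comm] at hbit
  have hmod := Nat.mod_two_eq_zero_or_one (popc n (L.getD i 0 &&& Ld.getD j 0))
  by_cases hij : i = j
  · subst hij
    simp only [decide_true, if_true] at hbit ⊢
    rcases hmod with h0 | h1
    · rw [h0] at hbit; simp at hbit
    · exact h1
  · rw [if_neg hij]
    simp only [hij, decide_false] at hbit
    rcases hmod with h0 | h1
    · exact h0
    · rw [h1] at hbit; simp at hbit

/-- **`bzCoreOK` through column words**: both rank certificates by `RankCert.checkCols` (column words `colsMY`, `colsMS` of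
their `rinv` supports), the logical-basis check by `logOKCols` (column words of `Hsyn`, `Hstab`, `Ld`), the dimension
identity and the parity witness as before. (definition, `decide +kernel`) -/
def bzCoreOKCols (n : ℕ) (Hsyn Hstab : List ℕ) (rcY rcS : RankCert) (L Ld : List ℕ) (ew : Option (List ℕ))
    (colsMY colsMS colsSyn colsStab colsLd : List ℕ) : Bool :=
  rcY.checkCols Hsyn colsMY && rcS.checkCols Hstab colsMS && logOKCols colsSyn colsStab colsLd L Ld &&
    (n == rcY.r + rcS.r + L.length) && parityPartOK n Hsyn ew

/-- **Bridge** for `bzCoreOK` (the `hcore` hypothesis of `bzAut_lower_sound[_sem]`, `bzAut_perm_lower[…]`, …). -/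
theorem bzCoreOK_of_cols {n : ℕ} {Hsyn Hstab : List ℕ} {rcY rcS : RankCert} {L Ld : List ℕ} {ew : Option (List ℕ)}
    {colsMY colsMS colsSyn colsStab colsLd : List ℕ} (hMY : colWords n rcY.rinv = colsMY)
    (hMS : colWords n rcS.rinv = colsMS) (hS : colWords n Hsyn = colsSyn) (hT : colWords n Hstab = colsStab)
    (hL : colWords n Ld = colsLd)
    (h : bzCoreOKCols n Hsyn Hstab rcY rcS L Ld ew colsMY colsMS colsSyn colsStab colsLd = true) :
    bzCoreOK n Hsyn Hstab rcY rcS L Ld ew = true := by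
  simp only [bzCoreOKCols, Bool.and_eq_true] at h
  obtain ⟨⟨⟨⟨hY, hZ⟩, hlog⟩, hdim⟩, hpar⟩ := h
  simp only [bzCoreOK, Bool.and_eq_true]
  exact ⟨⟨⟨⟨RankCert.check_of_checkCols hMY hY, RankCert.check_of_checkCols hMS hZ⟩, logOK_of_cols hS hT hL hlog⟩, hdim⟩,
    hpar⟩

/-! ## Controls (kernel `decide`) -/

/-- Steane: the core check of the `Z` side through column words (`bzSteane` data of type-10's controls). -/
example : bzCoreOKCols 7 certSteane7.HX certSteane7.HZ bzSteane.rcX bzSteane.rcZ bzSteane.LZ bzSteane.LX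
    bzSteane.sideZ.evenWitness (colWords 7 bzSteane.rcX.rinv) (colWords 7 bzSteane.rcZ.rinv) (colWords 7 certSteane7.HX)
    (colWords 7 certSteane7.HZ) (colWords 7 bzSteane.LX) = true := by decide

/-- `[[4,2,2]]`: the rank certificate of `H = [1111₂]` passes the column-word check with `colWords 4 rinv` as data. -/
example : rankCertC422.checkCols [15] (colWords 4 rankCertC422.rinv) = true := by decide

end Summit.Ventures.QEC.Census
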